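import Summits.AtomisticToContinuum.HydrodynamicLimit.Theorems.StiffCollisionalRelaxationAprioriBoundsEquilibriumStatics
import Mathlib.Analysis.SpecialFunctions.Pow.Asymptotics
import HarnessLib

/-!
# The ceiling at homogeneous data: the fixed-point packing bound along every hard-sphere flow

Supporting file of the line `Sketch` for the crux `AprioriBounds` (stmt-AtomisticToContinuum-14827;
`Summit.AtomisticToContinuum.HydrodynamicLimit.Theses.StiffCollisionalRelaxation.AprioriBounds`), lead prover
`prover-line-stmt-AtomisticToContinuum-14827-c2-0`.  It serves the registered stub `stub_coldJam` (component (ii) of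
the crux, "no mesoscopic cell is ever jammed": its event `{1 < ρ̄σ³ ∧ cold}` is a sub-event of the level-`1`
half-ceiling, which the landed `halfCeiling_of_ceilingFixed` derives from a FIXED-`(s, x)` packing bound at half the
level) by delivering the EQUILIBRIUM INSTANCE of that fixed-point bound: at the homogeneous local Gibbs data
`(a₀, u₀, θ₀) = (1, 0, θ₀)`, for EVERY family of hard-sphere flows `Φ_N`, every `N`, every time `s` and every block
centre `x`,

  `P_N {z | 1/2 < ρ̄_N(Φ_s z, x) σ³} ≤ δ_N`,  `(N+1)² δ_N → 0`,

where `ρ̄_N(w, x) = (N+1)⁻¹ ∑ᵢ φ_N(xᵢ(w) − x)` is the block density of an admissible kernel `φ_N`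
(`0 ≤ φ_N ≤ C(N+1)^{3γ}`, `∫φ_N = 1`, `γ < 1/3`), GIVEN the static Chernoff upper tail of the canonical
hard-sphere gas as the hypothesis `hstat` (interface `H-up`, proved in the sibling file
`StiffCollisionalRelaxationAprioriBoundsCeilingStatics.lean`, `posGibbs_sum_gt_le`; the lead discharges it at
assembly).

Proof (`ceilingFixed_homogeneous_of_static`; quantifier form `ceilingFixed_homogeneous_of_hUp`, the sub-goal
registered on the crux item for this file):
* the homogeneous law `P_N = localGibbsMeasure σ 1 0 θ₀ N` (`localGibbsLaw_eq`) is invariant under every `Φ_s`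
  (`flow_invariance_homogeneous`), so `P_N(Φ_s⁻¹ E) ≤ P_N(E)` for the time-zero event `E = {1/2 < ρ̄σ³}`;
* `E` is positional: `E ⊆ pos⁻¹ S`, `S = {(N+1) K ∫g < ∑ᵢ g(xᵢ)}` with `g = φ_N(· − x)`, `∫g = 1` (translation
  invariance of Haar measure on `𝕋³`) and `K = 1/(2σ³) ≥ 4 > 2` (as `σ ≤ 1/2`); the position marginal of `P_N` is the
  canonical gas `posGibbsMeasure 1 ε_N (N+1)` (`localGibbsMeasure_preimage_pos`);
* `hstat` with `L = C(N+1)^{3γ} + 1` bounds `posGibbs(S) ≤ exp(−(N+1) h / L)`, `h = K log(K/2) − K + 2 > 0`, and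
  `(N+1)/L ≥ (N+1)^{1−3γ}/(C+1)`, so `δ_N := exp(−(h/(C+1)) (N+1)^{1−3γ})` works:
  `(N+1)² e^{−b (N+1)^{a}} → 0` (`tendsto_rpow_mul_exp_neg_mul_atTop_nhds_zero`).

No new definitions, no named facts; axioms `propext`, `Classical.choice`, `Quot.sound`.
-/

noncomputable section

open MeasureTheory Filter Set Topology
open scoped ENNReal

namespace Summit.AtomisticToContinuum.HydrodynamicLimit.Theorems.AdiabatCeiling

open Literature.MathematicalPhysics.KineticTheory Literature.Analysis.FluidPDE

/-! ## §1 Two real-variable lemmas: the Chernoff rate is positive, stretched exponentials beat squares -/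

/-- **The Chernoff rate is positive**: `K log(K/2) − K + 2 = 2 (y log y − y + 1) > 0` for `y = K/2 > 1`
(from `log (1/y) < 1/y − 1`, `Real.log_lt_sub_one_of_pos`). -/
theorem ceilingHom_rate_pos {K : ℝ} (hK : 2 < K) : 0 < K * Real.log (K / 2) - K + 2 := by
  have hy : 1 < K / 2 := by linarith
  have hy0 : 0 < K / 2 := by linarith
  have hne : (K / 2)⁻¹ ≠ 1 := fun h1 => hy.ne' (inv_eq_one.1 h1)
  have h := Real.log_lt_sub_one_of_pos (inv_pos.2 hy0) hne
  rw [Real.log_inv] at h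
  -- `h : -log (K/2) < (K/2)⁻¹ - 1`; multiply by `K/2 > 0`
  have hmul : K / 2 * (1 - (K / 2)⁻¹) < K / 2 * Real.log (K / 2) :=
    mul_lt_mul_of_pos_left (by linarith) hy0
  rw [mul_sub, mul_inv_cancel₀ hy0.ne', mul_one] at hmul
  linarith

/-- **Stretched exponentials beat squares**: `(N+1)² exp(−b (N+1)^a) → 0` for `a, b > 0`
(`tendsto_rpow_mul_exp_neg_mul_atTop_nhds_zero` with exponent `2/a` along `u_N = (N+1)^a → ∞`). -/
theorem ceilingHom_tendsto {a b : ℝ} (ha : 0 < a) (hb : 0 < b) :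
    Tendsto (fun N : ℕ => ((N : ℝ) + 1) ^ 2 * Real.exp (-(b * ((N : ℝ) + 1) ^ a))) atTop (𝓝 0) := by
  have h1 : Tendsto (fun N : ℕ => (N : ℝ) + 1) atTop atTop :=
    tendsto_atTop_add_const_right _ 1 tendsto_natCast_atTop_atTop
  have hu : Tendsto (fun N : ℕ => ((N : ℝ) + 1) ^ a) atTop atTop := (tendsto_rpow_atTop ha).comp h1
  have h := (tendsto_rpow_mul_exp_neg_mul_atTop_nhds_zero (2 / a) b hb).comp hu
  refine h.congr fun N => ?_
  have hn : (0 : ℝ) ≤ (N : ℝ) + 1 := by positivity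
  have h2 : a * (2 / a) = 2 := by field_simp
  simp only [Function.comp_apply]
  rw [← Real.rpow_mul hn, h2, Real.rpow_two, neg_mul]

/-! ## §2 The fixed-point packing bound at homogeneous data, from the static Chernoff bound -/

/-- **The ceiling at homogeneous data, for every flow, from the static bound** (equilibrium instance of the
fixed-`(s, x)` half-level packing bound consumed by `halfCeiling_of_ceilingFixed`).  Let `0 < σ ≤ 1/2`,
`θ₀ > 0`, and assume the static Chernoff upper tail `hstat` of the canonical gas `posGibbsMeasure 1 ε_N (N+1)`
(interface `H-up` = `posGibbs_sum_gt_le`).  Then for every family of hard-sphere flows `Φ_N` and every admissible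
kernel family `φ_N` (`0 < γ < 1/3`) there is a rate `δ_N` with `(N+1)² δ_N → 0` such that for all `N`, all times
`s` and all centres `x`,
`localGibbsLaw σ 1 0 θ₀ N Φ_N {z | 1/2 < ρ̄_N(Φ_s z, x) σ³} ≤ δ_N`.
Proof: flow invariance of the homogeneous law (`flow_invariance_homogeneous`) removes `Φ_s`; the event is
positional and the position marginal is the canonical gas (`localGibbsMeasure_preimage_pos`); `hstat` with
`g = φ_N(· − x)`, `∫g = 1`, `L = C(N+1)^{3γ} + 1`, `K = 1/(2σ³)` gives `exp(−(N+1)h/L) ≤ exp(−(h/(C+1))(N+1)^{1−3γ})`,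
`h = K log(K/2) − K + 2 > 0` (`ceilingHom_rate_pos`, `ceilingHom_tendsto`). -/
theorem ceilingFixed_homogeneous_of_static {σ θ₀ : ℝ} (hσ : 0 < σ) (hσ2 : σ ≤ 1 / 2) (hθ : 0 < θ₀)
    (hstat : ∀ (N : ℕ) (g : T3 → ℝ), Measurable g → ∀ (L : ℝ), 0 < L → (∀ y, 0 ≤ g y) →
      (∀ y, g y ≤ L) → ∀ (K : ℝ), 2 < K →
        posGibbsMeasure (fun _ => (1 : ℝ)) (hsDiameter σ N) (N + 1)
            {x | ((N : ℝ) + 1) * K * (∫ y, g y) < ∑ i, g (x i)} ≤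
          ENNReal.ofReal (Real.exp (-((((N : ℝ) + 1) * ∫ y, g y) / L * (K * Real.log (K / 2) - K + 2)))))
    (Φ : (N : ℕ) → HardSphereFlow (Torus.geometry (Fin 3)) (hsDiameter σ N) (N + 1))
    {γ C : ℝ} {φ : ℕ → T3 → ℝ} (hγ : 0 < γ) (hγ1 : γ < 1 / 3)
    (hadm : (∀ N, Literature.Analysis.FunctionSpaces.Torus.IsSmooth (φ N)) ∧ (∀ N y, 0 ≤ φ N y) ∧
      (∀ N, ∫ y, φ N y = 1) ∧
      (∀ (N : ℕ) y, ((N : ℝ) + 1) ^ (-γ) ≤ Torus.euclidDist y 0 → φ N y = 0) ∧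
      (∀ (N : ℕ) y, φ N y ≤ C * ((N : ℝ) + 1) ^ (3 * γ)) ∧
      (∀ (N : ℕ) y, ‖Literature.Analysis.FunctionSpaces.Torus.gradient (φ N) y‖ ≤
        C * ((N : ℝ) + 1) ^ (4 * γ))) :
    ∃ δ : ℕ → ℝ, Tendsto (fun N : ℕ => ((N : ℝ) + 1) ^ 2 * δ N) atTop (𝓝 0) ∧
      ∀ (N : ℕ) (s : ℝ) (x : T3),
        localGibbsLaw σ (fun _ => 1) (fun _ => 0) (fun _ => θ₀) N (Φ N)
            {z | 1 / 2 < empiricalDensityField ((Φ N).flow s z) (fun y => φ N (y - x)) * σ ^ 3} ≤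
          ENNReal.ofReal (δ N) := by
  obtain ⟨hsm, hφ0, hφ1, -, hφC, -⟩ := hadm
  -- the constants: `K = 1/(2σ³) ≥ 4 > 2` (`σ ≤ 1/2`), the rate `h > 0`, `C ≥ 0`, `a = 1 - 3γ > 0`, `b = h/(C+1) > 0`
  have hσ3 : 0 < σ ^ 3 := by positivity
  obtain ⟨K, hK⟩ : ∃ K : ℝ, K = 1 / (2 * σ ^ 3) := ⟨_, rfl⟩
  have hσ38 : σ ^ 3 ≤ (1 / 2) ^ 3 := pow_le_pow_left₀ hσ.le hσ2 3
  have hK2 : 2 < K := by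
    rw [hK, lt_div_iff₀ (by positivity)]
    norm_num at hσ38
    linarith
  have hh0 : 0 < K * Real.log (K / 2) - K + 2 := ceilingHom_rate_pos hK2
  have hC : 0 ≤ C := by
    have h1 := hφC 0 0
    simp only [Nat.cast_zero, zero_add, Real.one_rpow, mul_one] at h1
    exact (hφ0 0 0).trans h1
  have ha0 : 0 < 1 - 3 * γ := by linarith
  have hb0 : 0 < (K * Real.log (K / 2) - K + 2) / (C + 1) := div_pos hh0 (by linarith)
  refine ⟨fun N => Real.exp (-((K * Real.log (K / 2) - K + 2) / (C + 1) * ((N : ℝ) + 1) ^ (1 - 3 * γ))),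
    ceilingHom_tendsto ha0 hb0, fun N s x => ?_⟩
  have hn : (0 : ℝ) < (N : ℝ) + 1 := by positivity
  -- the observable `g = φ_N (· - x)`: measurable, `0 ≤ g ≤ L = C (N+1)^{3γ} + 1`, `∫ g = 1`
  set g : T3 → ℝ := fun y => φ N (y - x) with hg
  have hgm : Measurable g := ((hsm N).continuous.comp (continuous_sub_right x)).measurable
  have hg0 : ∀ y, 0 ≤ g y := fun y => hφ0 N _
  have hm1 : 1 ≤ ((N : ℝ) + 1) ^ (3 * γ) := Real.one_le_rpow (by linarith) (by linarith)
  obtain ⟨L, hL⟩ : ∃ L : ℝ, L = C * ((N : ℝ) + 1) ^ (3 * γ) + 1 := ⟨_, rfl⟩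
  have hL0 : 0 < L := by
    rw [hL]
    exact add_pos_of_nonneg_of_pos (mul_nonneg hC (by positivity)) one_pos
  have hgL : ∀ y, g y ≤ L := fun y => by
    rw [hL]
    exact (hφC N _).trans (le_add_of_nonneg_right zero_le_one)
  have hIg : ∫ y, g y = 1 := by
    rw [hg]
    exact (integral_sub_right_eq_self (μ := volume) (φ N) x).trans (hφ1 N)
  -- the positional super-level event and its measurability
  obtain ⟨S, hS⟩ : ∃ S : Set (Fin (N + 1) → T3),
      S = {p | ((N : ℝ) + 1) * K * (∫ y, g y) < ∑ i, g (p i)} := ⟨_, rfl⟩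
  have hSm : MeasurableSet S := by
    rw [hS]
    exact measurableSet_lt measurable_const
      (Finset.measurable_sum _ fun i _ => hgm.comp (measurable_pi_apply i))
  -- `{1/2 < ρ̄(Φ_s z, x) σ³} ⊆ Φ_s⁻¹ (pos⁻¹ S)` (in fact equal): `(N+1)⁻¹ (∑ g) σ³ > 1/2 ↔ (N+1)/(2σ³) < ∑ g`
  have hsub : {z : Config (N + 1) (Fin 3) T3 |
        1 / 2 < empiricalDensityField ((Φ N).flow s z) g * σ ^ 3} ⊆
      (Φ N).flow s ⁻¹' ((fun (z : Config (N + 1) (Fin 3) T3) (i : Fin (N + 1)) => (z i).1) ⁻¹' S) := by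
    intro z hz
    rw [Set.mem_setOf_eq, empiricalDensityField_eq_sum] at hz
    push_cast at hz
    rw [mul_assoc, inv_mul_eq_div, lt_div_iff₀ hn] at hz
    rw [Set.mem_preimage, Set.mem_preimage, hS, Set.mem_setOf_eq, hIg, mul_one, hK, mul_one_div,
      div_lt_iff₀ (by positivity : (0 : ℝ) < 2 * σ ^ 3)]
    linarith
  -- invariance removes the flow, the position marginal is the canonical gas, then `hstat`
  rw [localGibbsLaw_eq]
  have hinv := flow_invariance_homogeneous σ θ₀ N (Φ N) s
  have hmarg : localGibbsMeasure σ (fun _ => 1) (fun _ => 0) (fun _ => θ₀) N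
        ((fun (z : Config (N + 1) (Fin 3) T3) (i : Fin (N + 1)) => (z i).1) ⁻¹' S) =
      posGibbsMeasure (fun _ => (1 : ℝ)) (hsDiameter σ N) (N + 1) S :=
    localGibbsMeasure_preimage_pos (a₀ := fun _ => (1 : ℝ)) (θ₀ := fun _ => θ₀) (u₀ := fun _ => (0 : V3))
      continuous_const continuous_const continuous_const (fun _ => zero_le_one) (fun _ => hθ) σ N hSm
  have hstatN := hstat N g hgm L hL0 hg0 hgL K hK2
  rw [← hS] at hstatN
  -- the comparison of the exponents: `b (N+1)^{1-3γ} ≤ (N+1) h / L`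
  have hkey : ((N : ℝ) + 1) ^ (1 - 3 * γ) / (C + 1) ≤ ((N : ℝ) + 1) / L := by
    rw [Real.rpow_sub hn, Real.rpow_one, div_div]
    refine div_le_div_of_nonneg_left hn.le hL0 ?_
    rw [hL]
    nlinarith [hm1, hC]
  have hexp : Real.exp (-((((N : ℝ) + 1) * ∫ y, g y) / L * (K * Real.log (K / 2) - K + 2))) ≤
      Real.exp (-((K * Real.log (K / 2) - K + 2) / (C + 1) * ((N : ℝ) + 1) ^ (1 - 3 * γ))) := by
    refine Real.exp_le_exp.2 (neg_le_neg ?_)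
    rw [hIg, mul_one]
    calc (K * Real.log (K / 2) - K + 2) / (C + 1) * ((N : ℝ) + 1) ^ (1 - 3 * γ)
        = (K * Real.log (K / 2) - K + 2) * (((N : ℝ) + 1) ^ (1 - 3 * γ) / (C + 1)) := by ring
      _ ≤ (K * Real.log (K / 2) - K + 2) * (((N : ℝ) + 1) / L) := mul_le_mul_of_nonneg_left hkey hh0.le
      _ = ((N : ℝ) + 1) / L * (K * Real.log (K / 2) - K + 2) := by ring
  calc localGibbsMeasure σ (fun _ => 1) (fun _ => 0) (fun _ => θ₀) N
        {z | 1 / 2 < empiricalDensityField ((Φ N).flow s z) g * σ ^ 3}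
      ≤ localGibbsMeasure σ (fun _ => 1) (fun _ => 0) (fun _ => θ₀) N
          ((Φ N).flow s ⁻¹' ((fun (z : Config (N + 1) (Fin 3) T3) (i : Fin (N + 1)) => (z i).1) ⁻¹' S)) :=
        measure_mono hsub
    _ ≤ localGibbsMeasure σ (fun _ => 1) (fun _ => 0) (fun _ => θ₀) N
          ((fun (z : Config (N + 1) (Fin 3) T3) (i : Fin (N + 1)) => (z i).1) ⁻¹' S) :=
        hinv.measure_preimage_le _
    _ = posGibbsMeasure (fun _ => (1 : ℝ)) (hsDiameter σ N) (N + 1) S := hmarg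
    _ ≤ ENNReal.ofReal (Real.exp (-((((N : ℝ) + 1) * ∫ y, g y) / L * (K * Real.log (K / 2) - K + 2)))) :=
        hstatN
    _ ≤ ENNReal.ofReal (Real.exp
          (-((K * Real.log (K / 2) - K + 2) / (C + 1) * ((N : ℝ) + 1) ^ (1 - 3 * γ)))) :=
        ENNReal.ofReal_le_ofReal hexp

/-- **The ceiling at homogeneous data, quantifier form** (the sub-goal registered on the crux item for this
file, consumed by the lead's assembly of the equilibrium rung of (ii)): for all `σ, θ₀` with `0 < σ ≤ 1/2`,
`0 < θ₀`, the static Chernoff bound `H-up` for `σ` implies, for every family of hard-sphere flows and every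
admissible kernel family (`0 < γ < 1/3`), a rate `δ_N` with `(N+1)² δ_N → 0` and
`localGibbsLaw σ 1 0 θ₀ N Φ_N {1/2 < ρ̄_N(Φ_s z, x) σ³} ≤ δ_N` for all `N, s, x`
(`ceilingFixed_homogeneous_of_static`). -/
theorem ceilingFixed_homogeneous_of_hUp :
    ∀ (σ θ₀ : ℝ), 0 < σ → σ ≤ 1 / 2 → 0 < θ₀ →
      (∀ (N : ℕ) (g : T3 → ℝ), Measurable g → ∀ (L : ℝ), 0 < L → (∀ y, 0 ≤ g y) → (∀ y, g y ≤ L) →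
        ∀ (K : ℝ), 2 < K →
          posGibbsMeasure (fun _ => (1 : ℝ)) (hsDiameter σ N) (N + 1)
              {x | ((N : ℝ) + 1) * K * (∫ y, g y) < ∑ i, g (x i)} ≤
            ENNReal.ofReal (Real.exp (-((((N : ℝ) + 1) * ∫ y, g y) / L * (K * Real.log (K / 2) - K + 2))))) →
      ∀ (Φ : (N : ℕ) → HardSphereFlow (Torus.geometry (Fin 3)) (hsDiameter σ N) (N + 1)) (γ C : ℝ)
        (φ : ℕ → T3 → ℝ), 0 < γ → γ < 1 / 3 →
        ((∀ N, Literature.Analysis.FunctionSpaces.Torus.IsSmooth (φ N)) ∧ (∀ N y, 0 ≤ φ N y) ∧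
          (∀ N, ∫ y, φ N y = 1) ∧
          (∀ (N : ℕ) y, ((N : ℝ) + 1) ^ (-γ) ≤ Torus.euclidDist y 0 → φ N y = 0) ∧
          (∀ (N : ℕ) y, φ N y ≤ C * ((N : ℝ) + 1) ^ (3 * γ)) ∧
          (∀ (N : ℕ) y, ‖Literature.Analysis.FunctionSpaces.Torus.gradient (φ N) y‖ ≤
            C * ((N : ℝ) + 1) ^ (4 * γ))) →
        ∃ δ : ℕ → ℝ, Tendsto (fun N : ℕ => ((N : ℝ) + 1) ^ 2 * δ N) atTop (𝓝 0) ∧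
          ∀ (N : ℕ) (s : ℝ) (x : T3),
            localGibbsLaw σ (fun _ => 1) (fun _ => 0) (fun _ => θ₀) N (Φ N)
                {z | 1 / 2 < empiricalDensityField ((Φ N).flow s z) (fun y => φ N (y - x)) * σ ^ 3} ≤
              ENNReal.ofReal (δ N) :=
  fun _ _ hσ hσ2 hθ hstat Φ _ _ _ hγ hγ1 hadm =>
    ceilingFixed_homogeneous_of_static hσ hσ2 hθ hstat Φ hγ hγ1 hadm

end Summit.AtomisticToContinuum.HydrodynamicLimit.Theorems.AdiabatCeiling

end
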